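import Summits.CriticalPhenomena.PercolationContinuityZ3.Theorems.PercNearOneGluingNoHeavyQuantFarTreeHubBlocksProfile
import HarnessLib

/-!
# QUANT lane R8 tool: the dual certificate and the UNIFORM-WINDOW vertex form for MONOTONE hub laws, and
# FAR for 'hub + leaves + any root blocks' conditional on the uniform-window vertex inequalities

builds on p205010 (kernel theorem, internal audit signed; external expert review pending)

Support file (`--supports stmt-CriticalPhenomena-4575`), QUANT lane typer seat prim-quant-stmt (gen 13); memo
`run/shared/lean/prim/quant/prim-quant-stmt-g13/MONO-RELAXATION.md` §1.  Unit-weight twins of gen 12's `Quant.ratioRegular_expectation_ge`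
(`…QuantRatioRegularCertificate.lean`), `Quant.ratioRegular_expectation_ge_of_vertices` / `Quant.pb_expectation_ge_of_vertices`
(`…QuantRatioRegularVertexForm.lean`) and `Quant.farTree_hubBlocks_of_vertices` (`…QuantFarTreeHubBlocksProfile.lean`).  Theorems only; no
definitions, no sorries, standard axioms.

Gen-13 finding (memo §1): the profile conjecture for 'hub + root blocks' holds numerically (exact census 340 000 / 0) under the WEAKER hub hypothesis
"pmf nondecreasing on `[0, ⌊μ⌋]`" (every Poisson-binomial law: `Quant.pb_pmf_mono`).  The cone of such laws has extreme rays `1_{[t,n]}`, so the LP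
certificate loses its Poisson weights and the vertices become uniform windows `U[t,n] ⊕ δ_{b₁}`:

* `Quant.mono_expectation_ge` — law `p` on `{0,…,m}` with mean `μ`, `n ≤ μ`, `p(b−1) ≤ p(b)` for `1 ≤ b ≤ n`; if a real `ν` has `ν·(b − μ) ≤ ℓ b − τ`
  for `n < b ≤ m` and `0 ≤ Σ_{i=t}^{n} (ℓ i − τ − ν·(i − μ))` for every `t ≤ n`, then `τ ≤ Σ_b p b·ℓ b` (Abel summation against the nonnegative tails,
  `Quant.sum_mul_nonneg_of_monotone_of_tails_nonneg` with unit weights).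
* `Quant.mono_expectation_ge_of_vertices` — the UNIFORM-WINDOW VERTEX INEQUALITIES
  `(V^u_{t,b₁})  0 ≤ (Σ_{i=t}^{n} (ℓ i − τ))·(b₁ − μ) + (ℓ b₁ − τ)·Σ_{i=t}^{n} (μ − i)`  for all `t ≤ n < b₁ ≤ m` (`n ≤ μ < n+1`, `n < m`)
  imply `τ ≤ Σ_b p b·ℓ b` for every law that is monotone below the mean (`ν :=` least top slope).
* `Quant.pb_expectation_ge_of_monoVertices` — the Poisson-binomial instance (`Quant.pb_pmf_mono_succ`, `Quant.pb_mean`, `Quant.pb_levels_sum_one`).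
* `Quant.farTree_hubBlocks_of_monoVertices` — **FAR at every layer for 'hub + leaves + ANY root blocks', CONDITIONAL on `(V^u_{t,b₁})`** for the block
  profile `ℓ b = P(W ≥ j+1−b) + ((1−q h)/q h)·P(W ≥ j+1)`, through the unconditional reduction `Quant.farTree_hubBlocks_of_profile`.
So a proof of the pure-rational family `(V^u_{t,b₁})` (no Poisson weights) closes LEAD-NOTES-G6 N14 (4) with no further plumbing.
[cite: KozmaNitzan2024, Conjecture 3 (p. 15)] (the gluing rows served); the statements are [this work].
-/

noncomputable section

namespace Summit.CriticalPhenomena.PercolationContinuityZ3.Theorems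

namespace Quant

open Finset MeasureTheory
open Literature.Probability.LatticeModels
open Literature.Probability.Percolation
open scoped Classical

/-- **The certificate for laws monotone below the mean.**  Let `p` be a law on `{0,…,m}` with mean `μ` and let `n ≤ μ` (e.g. `n = ⌊μ⌋`), with
`p(b−1) ≤ p b` for `1 ≤ b ≤ n`.  If some real `ν` satisfies `ν·(b − μ) ≤ ℓ b − τ` for all `n < b ≤ m` and `0 ≤ Σ_{i=t}^{n} (ℓ i − τ − ν·(i − μ))`
for all `t ≤ n`, then `τ ≤ Σ_{b ≤ m} p b · ℓ b`. [this work] -/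
theorem mono_expectation_ge (m n : ℕ) (μ τ ν : ℝ) (p ℓ : ℕ → ℝ) (hnμ : (n : ℝ) ≤ μ)
    (hp0 : ∀ b, 0 ≤ p b)
    (hsum : ∑ b ∈ Finset.range (m + 1), p b = 1) (hmean : ∑ b ∈ Finset.range (m + 1), (b : ℝ) * p b = μ)
    (hmono : ∀ b, 1 ≤ b → b ≤ n → p (b - 1) ≤ p b)
    (htop : ∀ b, n < b → b ≤ m → ν * ((b : ℝ) - μ) ≤ ℓ b - τ)
    (htail : ∀ t, t ≤ n → 0 ≤ ∑ i ∈ Finset.Ico t (n + 1), (ℓ i - τ - ν * ((i : ℝ) - μ))) :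
    τ ≤ ∑ b ∈ Finset.range (m + 1), p b * ℓ b := by
  -- `n ≤ m`
  have hnm : n ≤ m := by
    by_contra h
    push Not at h
    have : ∑ b ∈ Finset.range (m + 1), (b : ℝ) * p b ≤ ∑ b ∈ Finset.range (m + 1), (m : ℝ) * p b := by
      refine Finset.sum_le_sum fun b hb => ?_
      have : (b : ℝ) ≤ m := by have := Finset.mem_range.1 hb; exact_mod_cast (by omega)
      exact mul_le_mul_of_nonneg_right this (hp0 b)
    rw [hmean, ← Finset.mul_sum, hsum, mul_one] at this
    have : (m : ℝ) < n := by exact_mod_cast h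
    linarith
  set s : ℕ → ℝ := fun b => ℓ b - τ - ν * ((b : ℝ) - μ) with hs
  -- (1) `Σ p ℓ − τ = Σ p s`
  have hS : ∑ b ∈ Finset.range (m + 1), p b * ℓ b - τ = ∑ b ∈ Finset.range (m + 1), p b * s b := by
    have e : ∀ b : ℕ, p b * s b = p b * ℓ b - τ * p b - ν * ((b : ℝ) * p b) + ν * μ * p b := fun b => by rw [hs]; ring
    rw [Finset.sum_congr rfl fun b _ => e b, Finset.sum_add_distrib, Finset.sum_sub_distrib, Finset.sum_sub_distrib,
      ← Finset.mul_sum, ← Finset.mul_sum, ← Finset.mul_sum, hsum, hmean]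
    ring
  -- (2) split at `n`
  have hsplit : ∑ b ∈ Finset.range (m + 1), p b * s b =
      ∑ b ∈ Finset.range (n + 1), p b * s b + ∑ b ∈ Finset.Ico (n + 1) (m + 1), p b * s b := by
    rw [Finset.range_eq_Ico, Finset.range_eq_Ico]
    exact (Finset.sum_Ico_consecutive (fun b => p b * s b) (by omega) (by omega)).symm
  have htopsum : 0 ≤ ∑ b ∈ Finset.Ico (n + 1) (m + 1), p b * s b := by
    refine Finset.sum_nonneg fun b hb => ?_
    rw [Finset.mem_Ico] at hb
    have h1 := htop b (by omega) (by omega)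
    have : 0 ≤ s b := by rw [hs]; linarith
    exact mul_nonneg (hp0 b) this
  -- (3) the low part by Abel summation with unit weights
  have hlow : 0 ≤ ∑ b ∈ Finset.range (n + 1), p b * s b := by
    refine sum_mul_nonneg_of_monotone_of_tails_nonneg p s n (hp0 0) hmono ?_
    intro t ht
    have := htail t ht
    refine le_of_le_of_eq this (Finset.sum_congr rfl fun i _ => ?_)
    rw [hs]
  have : 0 ≤ ∑ b ∈ Finset.range (m + 1), p b * ℓ b - τ := by
    rw [hS, hsplit]; exact add_nonneg hlow htopsum
  linarith

/-- **Uniform-window vertex form.**  Let `n ≤ μ < n + 1`, `n < m`.  If `(V^u_{t,b₁})`: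
`0 ≤ (Σ_{i=t}^{n} (ℓ i − τ))·(b₁ − μ) + (ℓ b₁ − τ)·Σ_{i=t}^{n} (μ − i)` holds for all `t ≤ n < b₁ ≤ m`, then every law `p` on `{0,…,m}` with mean `μ`
that is monotone below the mean satisfies `τ ≤ Σ_b p b·ℓ b`  (`ν :=` the least slope `(ℓ b₁ − τ)/(b₁ − μ)` over the top atoms). [this work] -/
theorem mono_expectation_ge_of_vertices (m n : ℕ) (μ τ : ℝ) (p ℓ : ℕ → ℝ) (hnμ : (n : ℝ) ≤ μ)
    (hμn : μ < n + 1) (hnm : n < m) (hp0 : ∀ b, 0 ≤ p b)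
    (hsum : ∑ b ∈ Finset.range (m + 1), p b = 1) (hmean : ∑ b ∈ Finset.range (m + 1), (b : ℝ) * p b = μ)
    (hmono : ∀ b, 1 ≤ b → b ≤ n → p (b - 1) ≤ p b)
    (hV : ∀ t b₁, t ≤ n → n < b₁ → b₁ ≤ m →
      0 ≤ (∑ i ∈ Finset.Ico t (n + 1), (ℓ i - τ)) * ((b₁ : ℝ) - μ) +
        (ℓ b₁ - τ) * ∑ i ∈ Finset.Ico t (n + 1), (μ - i)) :
    τ ≤ ∑ b ∈ Finset.range (m + 1), p b * ℓ b := by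
  set f : ℕ → ℝ := fun b => (ℓ b - τ) / ((b : ℝ) - μ) with hf
  have hne : (Finset.Ioc n m).Nonempty := ⟨m, by rw [Finset.mem_Ioc]; omega⟩
  obtain ⟨bs, hbs, hmin⟩ := Finset.exists_min_image (Finset.Ioc n m) f hne
  rw [Finset.mem_Ioc] at hbs
  set ν : ℝ := f bs with hν
  have hgap : ∀ b : ℕ, n < b → 0 < (b : ℝ) - μ := by
    intro b hb
    have : (n : ℝ) + 1 ≤ b := by exact_mod_cast hb
    linarith
  have htop : ∀ b, n < b → b ≤ m → ν * ((b : ℝ) - μ) ≤ ℓ b - τ := by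
    intro b hb hbm
    have h1 : ν ≤ f b := hmin b (by rw [Finset.mem_Ioc]; exact ⟨hb, hbm⟩)
    have h2 : f b * ((b : ℝ) - μ) = ℓ b - τ := by
      rw [hf]
      field_simp [(hgap b hb).ne']
    calc ν * ((b : ℝ) - μ) ≤ f b * ((b : ℝ) - μ) := mul_le_mul_of_nonneg_right h1 (hgap b hb).le
      _ = ℓ b - τ := h2
  have htail : ∀ t, t ≤ n → 0 ≤ ∑ i ∈ Finset.Ico t (n + 1), (ℓ i - τ - ν * ((i : ℝ) - μ)) := by
    intro t ht
    set S₁ : ℝ := ∑ i ∈ Finset.Ico t (n + 1), (ℓ i - τ) with hS₁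
    set D : ℝ := ∑ i ∈ Finset.Ico t (n + 1), (μ - (i : ℝ)) with hD
    have hVt := hV t bs ht hbs.1 hbs.2
    have hℓ : ℓ bs - τ = ν * ((bs : ℝ) - μ) := by
      rw [hν, hf]
      field_simp [(hgap bs hbs.1).ne']
    rw [hℓ] at hVt
    have hfac : S₁ * ((bs : ℝ) - μ) + ν * ((bs : ℝ) - μ) * D = ((bs : ℝ) - μ) * (S₁ + ν * D) := by ring
    rw [hfac] at hVt
    have hSD : 0 ≤ S₁ + ν * D := (mul_nonneg_iff_of_pos_left (hgap bs hbs.1)).mp hVt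
    have hre : ∑ i ∈ Finset.Ico t (n + 1), (ℓ i - τ - ν * ((i : ℝ) - μ)) = S₁ + ν * D := by
      rw [hS₁, hD, Finset.mul_sum, ← Finset.sum_add_distrib]
      exact Finset.sum_congr rfl fun i _ => by ring
    rw [hre]
    exact hSD
  exact mono_expectation_ge m n μ τ ν p ℓ hnμ hp0 hsum hmean hmono htop htail

variable {ι : Type*} [Fintype ι]

/-- **Poisson-binomial instance.**  For independent gates `q` and a finset `L` with `U_L = Σ_{i∈L} q_i`, `n ≤ U_L < n + 1`, `n < |L|`: if the
uniform-window vertex inequalities `(V^u_{t,b₁})` hold for a test function `ℓ` and level `τ` for all `t ≤ n < b₁ ≤ |L|`, then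
`τ ≤ Σ_{b ≤ |L|} P(N_L = b)·ℓ b`.  (The count law is monotone below its mean by `Quant.pb_pmf_mono_succ`.) [this work] -/
theorem pb_expectation_ge_of_monoVertices (q : ι → unitInterval) (L : Finset ι) (n : ℕ) (ℓ : ℕ → ℝ) (τ : ℝ)
    (hnU : (n : ℝ) ≤ ∑ i ∈ L, (q i : ℝ)) (hUn : ∑ i ∈ L, (q i : ℝ) < n + 1) (hnL : n < L.card)
    (hV : ∀ t b₁, t ≤ n → n < b₁ → b₁ ≤ L.card →
      0 ≤ (∑ i ∈ Finset.Ico t (n + 1), (ℓ i - τ)) * ((b₁ : ℝ) - ∑ i ∈ L, (q i : ℝ)) +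
        (ℓ b₁ - τ) * ∑ i ∈ Finset.Ico t (n + 1), ((∑ i ∈ L, (q i : ℝ)) - i)) :
    τ ≤ ∑ b ∈ Finset.range (L.card + 1),
      (prodBernoulli q).real {s : Set ι | (L.filter fun x => x ∈ s).card = b} * ℓ b := by
  set U : ℝ := ∑ i ∈ L, (q i : ℝ) with hU
  set P : ℕ → ℝ := fun b => (prodBernoulli q).real {s : Set ι | (L.filter fun x => x ∈ s).card = b} with hP
  have hp0 : ∀ b, 0 ≤ P b := fun b => measureReal_nonneg
  have hsum : ∑ b ∈ Finset.range (L.card + 1), P b = 1 := pb_levels_sum_one q L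
  have hmean : ∑ b ∈ Finset.range (L.card + 1), (b : ℝ) * P b = U := pb_mean q L
  have hmono : ∀ b, 1 ≤ b → b ≤ n → P (b - 1) ≤ P b := by
    intro b hb1 hbn
    have hbU : (((b - 1 : ℕ) : ℝ) + 1) ≤ U := by
      have e : (((b - 1 : ℕ) : ℝ) + 1) = b := by rw [Nat.cast_sub hb1]; push_cast; ring
      rw [e]
      have : (b : ℝ) ≤ n := by exact_mod_cast hbn
      linarith
    have := pb_pmf_mono_succ q L (b - 1) hbU
    have e : b - 1 + 1 = b := by omega
    rw [e] at this
    exact this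
  exact mono_expectation_ge_of_vertices L.card n U τ P ℓ hnU hUn hnL hp0 hsum hmean hmono hV

variable {n : ℕ}

/-- **FAR at every layer for 'hub + leaves + ANY root blocks', conditional on the uniform-window vertex inequalities.**  Setting of
`Quant.farTree_hubBlocks_of_profile` (observer `o`; hub `h` with leaf relays `L`; block vertices `K` with glued tails `B b`); `U = Σ_{ℓ∈L} q ℓ`, an
integer `n₀` with `n₀ ≤ U < n₀ + 1` and `n₀ < |L|`; block profile `ℓ b = P(W ≥ j+1−b) + ((1−q h)/q h)·P(W ≥ j+1)`.  If `(V^u_{t,b₁})` holds for `ℓ`, `τ`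
and all `t ≤ n₀ < b₁ ≤ |L|`, and `1 − q h·τ ≤ t`, then `P(#{a ∈ A counted} ≤ j) ≤ t`.  [this work] -/
theorem farTree_hubBlocks_of_monoVertices (q : Fin n → unitInterval) (o h : Fin n) (L K : Finset (Fin n)) (B : Fin n → Finset (Fin n))
    (depth : Fin n → ℕ) (par : Fin n → Fin n) (j n₀ : ℕ) (τ t : ℝ)
    (hK : ∀ b ∈ K, par b = o ∧ depth b = 0)
    (hL : ∀ a ∈ L, par a = h ∧ depth a = 1) (hB : ∀ b ∈ K, ∀ a ∈ B b, par a = b ∧ depth a = 1)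
    (hhL : h ∉ L) (hhK : h ∉ K) (hLK : Disjoint L K) (hLB : ∀ b ∈ K, Disjoint L (B b))
    (hKB : ∀ b ∈ K, ∀ b' ∈ K, b ∉ B b') (hBB : ∀ b ∈ K, ∀ b' ∈ K, b ≠ b' → Disjoint (B b) (B b'))
    (hqB : ∀ b ∈ K, ∀ a ∈ B b, q a = 1) (hqh : 0 < (q h : ℝ))
    (hnU : (n₀ : ℝ) ≤ ∑ i ∈ L, (q i : ℝ)) (hUn : ∑ i ∈ L, (q i : ℝ) < n₀ + 1) (hnL : n₀ < L.card)
    (hV : ∀ t' b₁, t' ≤ n₀ → n₀ < b₁ → b₁ ≤ L.card →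
      0 ≤ (∑ i ∈ Finset.Ico t' (n₀ + 1),
            (((prodBernoulli q).real {ω : Set (Fin n) | j + 1 - i ≤ ∑ x ∈ K.filter (fun x => x ∈ ω), ((B x).card + 1)} +
              (1 - (q h : ℝ)) / (q h : ℝ) *
                (prodBernoulli q).real {ω : Set (Fin n) | j + 1 ≤ ∑ x ∈ K.filter (fun x => x ∈ ω), ((B x).card + 1)}) - τ)) *
          ((b₁ : ℝ) - ∑ i ∈ L, (q i : ℝ)) +
        (((prodBernoulli q).real {ω : Set (Fin n) | j + 1 - b₁ ≤ ∑ x ∈ K.filter (fun x => x ∈ ω), ((B x).card + 1)} +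
              (1 - (q h : ℝ)) / (q h : ℝ) *
                (prodBernoulli q).real {ω : Set (Fin n) | j + 1 ≤ ∑ x ∈ K.filter (fun x => x ∈ ω), ((B x).card + 1)}) - τ) *
          ∑ i ∈ Finset.Ico t' (n₀ + 1), ((∑ i ∈ L, (q i : ℝ)) - i))
    (ht : 1 - (q h : ℝ) * τ ≤ t) :
    (prodBernoulli q).real {ω' : Set (Fin n) |
      ((L ∪ K.biUnion fun b => insert b (B b)).filter
        fun a => a = o ∨ ∀ i, i ≤ depth a → par^[i] a ∈ ω').card ≤ j} ≤ t := by
  set ℓ : ℕ → ℝ := fun b =>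
    (prodBernoulli q).real {ω : Set (Fin n) | j + 1 - b ≤ ∑ x ∈ K.filter (fun x => x ∈ ω), ((B x).card + 1)} +
      (1 - (q h : ℝ)) / (q h : ℝ) *
        (prodBernoulli q).real {ω : Set (Fin n) | j + 1 ≤ ∑ x ∈ K.filter (fun x => x ∈ ω), ((B x).card + 1)} with hℓ
  have hτ : τ ≤ ∑ b ∈ Finset.range (L.card + 1),
      (prodBernoulli q).real {ω : Set (Fin n) | (L.filter fun x => x ∈ ω).card = b} * ℓ b :=
    pb_expectation_ge_of_monoVertices q L n₀ ℓ τ hnU hUn hnL hV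
  exact (farTree_hubBlocks_of_profile q o h L K B depth par j τ hK hL hB hhL hhK hLK hLB hKB hBB hqB hqh hτ).trans ht

end Quant

end Summit.CriticalPhenomena.PercolationContinuityZ3.Theorems
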